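import Literature.AlgebraicGeometry.HodgeTheory.HypersurfaceLefschetz
import Literature.AlgebraicGeometry.HodgeTheory.GysinFormalism
import Literature.NumberTheory.Transcendental.AnalytificationProjProofs
import Literature.AlgebraicTopology.SingularHomology.CohomologyHomotopyInvariance
import Literature.AlgebraicGeometry.Motives.VarietiesQuasiCompactProofs
import Mathlib.LinearAlgebra.Matrix.Rank
import HarnessLib

/-!
# Lefschetz for smooth hypersurfaces (proof file, I): classes restricted from `ℙᴺ` are algebraic

Sibling proof file of `Literature/AlgebraicGeometry/HodgeTheory/HypersurfaceLefschetz.lean`, which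
vendors the NAMED FACT `Voisin2003_smoothHypersurface_algebraicClasses_eq_top` (C. Voisin, *Hodge
Theory and Complex Algebraic Geometry II*, §1.2.2 Thm. 1.23 and §1.2.3 Cor. 1.24–1.25: for a smooth
hypersurface `Y ⊂ ℙ^{n+1}_ℂ` and `0 < p < n`, `2p ≠ n`, `algebraicClasses Y p = Nᵖ H²ᵖ(Y(ℂ); ℂ) = ⊤`).
The printed proof has two halves:

1. (Lefschetz, Thm. 1.23 / Cor. 1.24–1.25) `H²ᵖ(Y, ℚ) = ℚ · hᵖ|_Y`: every class of `H²ᵖ(Y(ℂ))` is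
   RESTRICTED FROM THE AMBIENT PROJECTIVE SPACE (`ι^* : H²ᵖ(ℙ^{n+1}(ℂ)) → H²ᵖ(Y(ℂ))` is onto), proved
   in print by Morse theory on the affine variety `ℙ^{n+1} ∖ Y` (Andreotti–Frankel, Thm. 1.22) and
   Lefschetz duality — NOT in the tree, and not proved here;
2. (Voisin I §11.1.2; the use made of Cor. 1.24 in Rem. 1.26) `hᵖ|_Y = cl(Y ∩ L)` for a
   codimension-`p` linear subspace `L` in general position is the class of an ALGEBRAIC cycle, i.e.
   lies in `Nᵖ H²ᵖ(Y(ℂ); ℂ)`.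

This file PROVES half 2 on the tree's carriers, in the strong form needed by the `Nᵖ`-language of
`AlgebraicClasses` and for an arbitrary morphism to projective space:

* `map_projectiveSpace_mem_algebraicClasses`: for `Y` smooth projective of dimension `n` over `ℂ`,
  ANY morphism `ι : Y ⟶ ℙᴺ_ℂ` and ANY `p`, `ι^* H²ᵖ(ℙᴺ(ℂ); ℂ) ⊆ algebraicClasses Y p`;
* `algebraicClasses_eq_top_of_surjective_map`: hence `algebraicClasses Y p = ⊤` as soon as `ι^*` is
  onto in degree `2p` — which reduces the named fact to EXACTLY the Lefschetz surjectivity (half 1).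

Proof of half 2 (all from the tree and Mathlib):

* **Topology of `ℙᴺ ∖ L`.** For a continuous linear surjection `T : E → F` with a continuous
  section `S`, the open set `{[v] | T v ≠ 0} ⊆ ℙ(E)` retracts by the straight-line deformation
  `[S(Tv) + t(v − S(Tv))]` onto the section `[w] ↦ [S w]` of the projection `[v] ↦ [T v]` to
  `ℙ(F)` (`linHomotopy`); by homotopy invariance of singular cohomology (the tree's PROVED
  `singularCohomology.map_eq_of_homotopic'`, Hatcher §3.1) its cohomology is a retract of that of
  `ℙ(F)` (`subsingleton_singularCohomology_linComplSet`). For `F = ℂ^{m+1}`, `ℙ(F)` is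
  homeomorphic (`projPoint`, Serre GAGA §2 n°5, the tree's `isHomeomorph_projPoint`) to the complex
  points of the smooth projective `m`-fold `ℙᵐ_ℂ`, a closed `2m`-manifold with `Hᵏ = 0` for
  `k > 2m` (Hatcher Thm. 3.26 (c), the tree's `ComplexPoints.subsingleton_singularCohomology_of_lt`).
  Transporting along `projPoint` for `ℙᴺ` (`linComplHomeomorph`):
  `Hᵏ((ℙᴺ ∖ V₊(ℓ₀, …, ℓ_m))(ℂ); ℂ) = 0` for `k > 2m` and independent linear forms `ℓᵢ`
  (`subsingleton_singularCohomology_complexPointsCompl_linearSubspace`).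
* **Functoriality.** `(ι^* a)|_{(Y ∖ ι⁻¹L)(ℂ)}` is the pull-back of `a|_{(ℙᴺ ∖ L)(ℂ)} = 0`
  (`restrictCompl_preimage_map_eq_zero`).
* **General position** (Hartshorne I Thm. 7.2, I Ex. 1.8; II Ex. 3.20 for `dim + codim = n`): by
  induction, independent linear forms `ℓ₁, …, ℓ_j` with `dim {z}⁻ + j ≤ n` for every `z ∈ Y` with
  `ι(z) ∈ V₊(ℓ₁, …, ℓ_j)` — choose `ℓ_{j+1}` off the finitely many proper subspaces of forms
  vanishing at the generic points of the irreducible components of `ι⁻¹V₊(ℓ₁, …, ℓ_j)` (Noetherian,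
  sober) and off the span of the previous forms (Mathlib
  `Submodule.exists_forall_notMem_of_forall_ne_top`: `ℂ` is infinite); so `ι⁻¹V₊(ℓ₀, …, ℓ_m)` has
  codimension `≥ m + 1` pointwise (`exists_linearSubspace_le_coheight`).
* **Assembly.** `p = 0`: `algebraicClasses_zero`; `1 ≤ p ≤ N`: the three items with `m = p − 1`
  and `mem_supportedClasses_of_restrictCompl_eq_zero`; `p > N`: `H²ᵖ(ℙᴺ(ℂ); ℂ) = 0`.

## What is NOT here (the remaining input for `Voisin2003_smoothHypersurface_algebraicClasses_eq_top_holds`)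

The Lefschetz theorem on hyperplane sections itself (Voisin II Thm. 1.23: `ι^*` bijective on `Hᵏ`
for `k < n`, whence onto on `H²ᵖ` for `2p < n`; and for `n < 2p < 2n` the rank-one statement of
Cor. 1.25 by Poincaré duality together with `hᵖ|_Y ≠ 0`). Its printed proof needs the homotopy
type of smooth affine varieties (Andreotti–Frankel 1959 / Milnor, *Morse theory* §7; Voisin II
Thm. 1.22), for which the tree has no carrier yet.

## References

* [VoisinHodgeII2003] C. Voisin, Hodge Theory and Complex Algebraic Geometry II (CUP 2003), §1.2.2
  Thm. 1.22–1.23, §1.2.3 Cor. 1.24–1.25, Rem. 1.26 (PDF pp. 59–62 of the held copy).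
* [VoisinHodgeI2002] C. Voisin, Hodge Theory and Complex Algebraic Geometry I (CUP 2002), §11.1.2.
* [HatcherAT2002] A. Hatcher, Algebraic Topology (CUP 2002), §3.1 (homotopy invariance), §3.3
  Thm. 3.26 (c).
* [Hartshorne1977] R. Hartshorne, Algebraic Geometry (1977), I Thm. 7.2, I Ex. 1.8, II Prop. 2.5,
  II Ex. 3.20.
* [SerreGAGA1956] J.-P. Serre, GAGA, Ann. Inst. Fourier 6 (1956), §2 n°5 Prop. 2.
-/

noncomputable section

open scoped LinearAlgebra.Projectivization
open CategoryTheory AlgebraicGeometry Topology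
open Literature.AlgebraicTopology.SingularHomology

namespace Literature.AlgebraicGeometry.HodgeTheory

universe u

/-! ### The complement of a projective linear subspace retracts onto a complementary subspace -/

section LinCompl

variable {E F : Type u} [AddCommGroup E] [Module ℂ E] [AddCommGroup F] [Module ℂ F]

/-- The subset `{[v] | T v ≠ 0}` of the projective space `ℙ(E)` of a complex vector space `E`, for a
linear map `T : E → F`: the complement of the projective linear subspace `ℙ(ker T)`. [folklore] -/
def linComplSet (T : E →ₗ[ℂ] F) : Set (ℙ ℂ E) := {q | T q.rep ≠ 0}

/-- `[v] ∈ {T ≠ 0}` iff `T v ≠ 0` (independent of the representative). [folklore] -/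
theorem mk_mem_linComplSet_iff (T : E →ₗ[ℂ] F) {v : E} (hv : v ≠ 0) :
    Projectivization.mk ℂ v hv ∈ linComplSet T ↔ T v ≠ 0 := by
  obtain ⟨a, ha⟩ := Projectivization.exists_smul_eq_mk_rep ℂ v hv
  simp only [linComplSet, Set.mem_setOf_eq, ← ha, Units.smul_def, map_smul]
  exact smul_ne_zero_iff.trans (and_iff_right a.ne_zero)

/-- `[T (rep [v])] = [T v]` in `ℙ(F)`. [folklore] -/
theorem mk_map_rep_mk_eq (T : E →ₗ[ℂ] F) {v : E} (hv : v ≠ 0)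
    (h₁ : T (Projectivization.mk ℂ v hv).rep ≠ 0) (h₂ : T v ≠ 0) :
    Projectivization.mk ℂ (T (Projectivization.mk ℂ v hv).rep) h₁ =
      Projectivization.mk ℂ (T v) h₂ := by
  obtain ⟨a, ha⟩ := Projectivization.exists_smul_eq_mk_rep ℂ v hv
  rw [Projectivization.mk_eq_mk_iff]
  exact ⟨a, by simp only [← ha, Units.smul_def, map_smul]⟩

section Algebra

variable (T : E →ₗ[ℂ] F) (S : F →ₗ[ℂ] E)

/-- A section `S` of `T` does not kill nonzero vectors. [folklore] -/
theorem apply_ne_zero_of_section (hTS : ∀ w, T (S w) = w) {w : F} (hw : w ≠ 0) : S w ≠ 0 :=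
  fun h ↦ hw (by rw [← hTS w, h, map_zero])

/-- `[S w] ∈ {T ≠ 0}` for `w ≠ 0` and `S` a section of `T`. [folklore] -/
theorem mk_section_mem (hTS : ∀ w, T (S w) = w) {w : F} (hw : w ≠ 0) :
    Projectivization.mk ℂ (S w) (apply_ne_zero_of_section T S hTS hw) ∈ linComplSet T :=
  (mk_mem_linComplSet_iff _ _).2 (by rw [hTS]; exact hw)

/-- The straight-line deformation `v ↦ S(Tv) + t · (v − S(Tv))` from `S ∘ T` (`t = 0`) to the
identity (`t = 1`). [folklore] -/
def blend (t : ℝ) (v : E) : E := S (T v) + (t : ℂ) • (v - S (T v))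

/-- The deformation preserves `T` when `S` is a section of `T`. [folklore] -/
theorem apply_blend (hTS : ∀ w, T (S w) = w) (t : ℝ) (v : E) : T (blend T S t v) = T v := by
  simp only [blend, map_add, map_smul, map_sub, hTS, sub_self, smul_zero, add_zero]

/-- The deformation is linear in `v` (so descends to projective space). [folklore] -/
theorem blend_smul (t : ℝ) (c : ℂ) (v : E) : blend T S t (c • v) = c • blend T S t v := by
  simp only [blend, map_smul, smul_sub, smul_add, smul_comm (t : ℂ) c]

/-- At `t = 0` the deformation is `S ∘ T`. [folklore] -/
theorem blend_zero (v : E) : blend T S 0 v = S (T v) := by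
  simp [blend]

/-- At `t = 1` the deformation is the identity. [folklore] -/
theorem blend_one (v : E) : blend T S 1 v = v := by
  simp [blend]

/-- The deformation of a vector with `T v ≠ 0` stays nonzero. [folklore] -/
theorem blend_ne_zero (hTS : ∀ w, T (S w) = w) (t : ℝ) {v : E} (hv : T v ≠ 0) :
    blend T S t v ≠ 0 := by
  intro h
  have h2 := apply_blend T S hTS t v
  rw [h, map_zero] at h2
  exact hv h2.symm

/-- The deformation of a vector with `T v ≠ 0` stays in `{T ≠ 0}`. [folklore] -/
theorem mk_blend_mem (hTS : ∀ w, T (S w) = w) (t : ℝ) {v : E} (hv : T v ≠ 0) :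
    Projectivization.mk ℂ (blend T S t v) (blend_ne_zero T S hTS t hv) ∈ linComplSet T :=
  (mk_mem_linComplSet_iff _ _).2 (by rw [apply_blend T S hTS]; exact hv)

end Algebra

variable [TopologicalSpace E] [TopologicalSpace F]

/-- The restriction of the projection `{v ≠ 0} → ℙ(E)` (an open quotient map for the quotient
topology of `Literature/NumberTheory/Transcendental/ProjectiveSpace`) over any subset of `ℙ(E)` is
again an open quotient map. [folklore] -/
theorem isOpenQuotientMap_restrictPreimage_mk [ContinuousConstSMul ℂ E] (U : Set (ℙ ℂ E)) :
    IsOpenQuotientMap (U.restrictPreimage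
      (fun v : {v : E // v ≠ 0} ↦ Projectivization.mk ℂ v.1 v.2)) :=
  ⟨Set.restrictPreimage_surjective _ Projectivization.isOpenQuotientMap_mk.surjective,
    Projectivization.continuous_mk.restrictPreimage,
    Projectivization.isOpenMap_mk.restrictPreimage U⟩

variable (T : E →L[ℂ] F) (S : F →L[ℂ] E)

/-- The function of the linear projection `{[v] | T v ≠ 0} → ℙ(F)`, `[v] ↦ [T v]`. [folklore] -/
def linProjFun (q : linComplSet (T : E →ₗ[ℂ] F)) : ℙ ℂ F := Projectivization.mk ℂ (T q.1.rep) q.2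

/-- The linear projection `[v] ↦ [T v]` is continuous (it lifts to the continuous `v ↦ T v` along
the open quotient map `{v | T v ≠ 0} → {[v] | T v ≠ 0}`). [folklore] -/
theorem continuous_linProjFun [ContinuousConstSMul ℂ E] : Continuous (linProjFun T) := by
  rw [(isOpenQuotientMap_restrictPreimage_mk
    (linComplSet (T : E →ₗ[ℂ] F))).isQuotientMap.continuous_iff]
  have hmem : ∀ v : (fun v : {v : E // v ≠ 0} ↦ Projectivization.mk ℂ v.1 v.2) ⁻¹'
      linComplSet (T : E →ₗ[ℂ] F), T v.1.1 ≠ 0 :=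
    fun v ↦ (mk_mem_linComplSet_iff (T : E →ₗ[ℂ] F) v.1.2).1 v.2
  have hfun : (linProjFun T ∘ (linComplSet (T : E →ₗ[ℂ] F)).restrictPreimage
          (fun v : {v : E // v ≠ 0} ↦ Projectivization.mk ℂ v.1 v.2)) =
        fun v ↦ Projectivization.mk ℂ (T v.1.1) (hmem v) := by
    funext v
    exact mk_map_rep_mk_eq (T : E →ₗ[ℂ] F) v.1.2 _ _
  rw [hfun]
  have hc : Continuous fun v : (fun v : {v : E // v ≠ 0} ↦ Projectivization.mk ℂ v.1 v.2) ⁻¹'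
      linComplSet (T : E →ₗ[ℂ] F) ↦ (⟨T v.1.1, hmem v⟩ : {w : F // w ≠ 0}) :=
    (T.continuous.comp (continuous_subtype_val.comp continuous_subtype_val)).subtype_mk hmem
  exact (Projectivization.continuous_mk (𝕜 := ℂ) (W := F)).comp hc

/-- The linear projection `{[v] | T v ≠ 0} → ℙ(F)`, `[v] ↦ [T v]`, as a continuous map (projection
from the centre `ℙ(ker T)`). [folklore] -/
def linProj [ContinuousConstSMul ℂ E] : C(linComplSet (T : E →ₗ[ℂ] F), ℙ ℂ F) :=
  ⟨linProjFun T, continuous_linProjFun T⟩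

/-- The function of the section `ℙ(F) → {[v] | T v ≠ 0}`, `[w] ↦ [S w]`, of the linear projection,
for `S` a section of `T`. [folklore] -/
def linSectFun (hTS : ∀ w, T (S w) = w) (w : ℙ ℂ F) : linComplSet (T : E →ₗ[ℂ] F) :=
  ⟨Projectivization.mk ℂ (S w.rep)
      (apply_ne_zero_of_section (T : E →ₗ[ℂ] F) (S : F →ₗ[ℂ] E) hTS w.rep_nonzero),
    mk_section_mem (T : E →ₗ[ℂ] F) (S : F →ₗ[ℂ] E) hTS w.rep_nonzero⟩

/-- The section `[w] ↦ [S w]` is continuous (it lifts to `w ↦ S w` along the quotient map).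
[folklore] -/
theorem continuous_linSectFun (hTS : ∀ w, T (S w) = w) : Continuous (linSectFun T S hTS) := by
  rw [(Projectivization.isQuotientMap_mk (𝕜 := ℂ) (W := F)).continuous_iff]
  have hfun : (linSectFun T S hTS ∘ (fun v : {v : F // v ≠ 0} ↦ Projectivization.mk ℂ v.1 v.2)) =
      fun w ↦ ⟨Projectivization.mk ℂ (S w.1)
          (apply_ne_zero_of_section (T : E →ₗ[ℂ] F) (S : F →ₗ[ℂ] E) hTS w.2),
        mk_section_mem (T : E →ₗ[ℂ] F) (S : F →ₗ[ℂ] E) hTS w.2⟩ := by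
    funext w
    apply Subtype.ext
    simp only [Function.comp_apply, linSectFun]
    obtain ⟨a, ha⟩ := Projectivization.exists_smul_eq_mk_rep ℂ w.1 w.2
    rw [Projectivization.mk_eq_mk_iff]
    exact ⟨a, by simp only [← ha, Units.smul_def, map_smul]⟩
  rw [hfun]
  refine Continuous.subtype_mk ?_ _
  have hc : Continuous fun w : {v : F // v ≠ 0} ↦ (⟨S w.1,
      apply_ne_zero_of_section (T : E →ₗ[ℂ] F) (S : F →ₗ[ℂ] E) hTS w.2⟩ : {v : E // v ≠ 0}) :=
    (S.continuous.comp continuous_subtype_val).subtype_mk _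
  exact (Projectivization.continuous_mk (𝕜 := ℂ) (W := E)).comp hc

/-- The section `ℙ(F) → {[v] | T v ≠ 0}`, `[w] ↦ [S w]`, as a continuous map. [folklore] -/
def linSect (hTS : ∀ w, T (S w) = w) : C(ℙ ℂ F, linComplSet (T : E →ₗ[ℂ] F)) :=
  ⟨linSectFun T S hTS, continuous_linSectFun T S hTS⟩

/-- The function of the deformation of `{[v] | T v ≠ 0}`, `(t, [v]) ↦ [S(Tv) + t(v − S(Tv))]`.
[folklore] -/
def linHomotopyFun (hTS : ∀ w, T (S w) = w) (x : unitInterval × linComplSet (T : E →ₗ[ℂ] F)) :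
    linComplSet (T : E →ₗ[ℂ] F) :=
  ⟨Projectivization.mk ℂ (blend (T : E →ₗ[ℂ] F) (S : F →ₗ[ℂ] E) x.1 x.2.1.rep)
      (blend_ne_zero (T : E →ₗ[ℂ] F) (S : F →ₗ[ℂ] E) hTS x.1 x.2.2),
    mk_blend_mem (T : E →ₗ[ℂ] F) (S : F →ₗ[ℂ] E) hTS x.1 x.2.2⟩

/-- The deformation is continuous (it lifts along the open quotient map
`[0,1] × {v | T v ≠ 0} → [0,1] × {[v] | T v ≠ 0}`, a product of open quotient maps).
[folklore] -/
theorem continuous_linHomotopyFun [IsTopologicalAddGroup E] [ContinuousSMul ℂ E]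
    (hTS : ∀ w, T (S w) = w) : Continuous (linHomotopyFun T S hTS) := by
  have hq := (IsOpenQuotientMap.id (X := unitInterval)).prodMap
    (isOpenQuotientMap_restrictPreimage_mk (linComplSet (T : E →ₗ[ℂ] F)))
  rw [hq.isQuotientMap.continuous_iff]
  have hmem : ∀ v : (fun v : {v : E // v ≠ 0} ↦ Projectivization.mk ℂ v.1 v.2) ⁻¹'
      linComplSet (T : E →ₗ[ℂ] F), T v.1.1 ≠ 0 :=
    fun v ↦ (mk_mem_linComplSet_iff (T : E →ₗ[ℂ] F) v.1.2).1 v.2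
  have hfun : (linHomotopyFun T S hTS ∘ Prod.map id ((linComplSet (T : E →ₗ[ℂ] F)).restrictPreimage
          (fun v : {v : E // v ≠ 0} ↦ Projectivization.mk ℂ v.1 v.2))) =
        fun x ↦ ⟨Projectivization.mk ℂ (blend (T : E →ₗ[ℂ] F) (S : F →ₗ[ℂ] E) x.1 x.2.1.1)
            (blend_ne_zero (T : E →ₗ[ℂ] F) (S : F →ₗ[ℂ] E) hTS x.1 (hmem x.2)),
          mk_blend_mem (T : E →ₗ[ℂ] F) (S : F →ₗ[ℂ] E) hTS x.1 (hmem x.2)⟩ := by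
    funext x
    apply Subtype.ext
    simp only [Function.comp_apply, linHomotopyFun, Prod.map_fst, Prod.map_snd, id_eq]
    obtain ⟨a, ha⟩ := Projectivization.exists_smul_eq_mk_rep ℂ x.2.1.1 x.2.1.2
    rw [Projectivization.mk_eq_mk_iff]
    refine ⟨a, ?_⟩
    change a • blend (T : E →ₗ[ℂ] F) (S : F →ₗ[ℂ] E) x.1 x.2.1.1 =
      blend (T : E →ₗ[ℂ] F) (S : F →ₗ[ℂ] E) x.1 (Projectivization.mk ℂ x.2.1.1 x.2.1.2).rep
    rw [← ha, Units.smul_def, Units.smul_def, blend_smul]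
  rw [hfun]
  refine Continuous.subtype_mk ?_ _
  have hv : Continuous fun x : unitInterval ×
      ((fun v : {v : E // v ≠ 0} ↦ Projectivization.mk ℂ v.1 v.2) ⁻¹' linComplSet (T : E →ₗ[ℂ] F)) ↦
        (x.2.1.1 : E) :=
    continuous_subtype_val.comp (continuous_subtype_val.comp continuous_snd)
  have ht : Continuous fun x : unitInterval ×
      ((fun v : {v : E // v ≠ 0} ↦ Projectivization.mk ℂ v.1 v.2) ⁻¹' linComplSet (T : E →ₗ[ℂ] F)) ↦
        ((x.1 : ℝ) : ℂ) :=
    Complex.continuous_ofReal.comp (continuous_subtype_val.comp continuous_fst)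
  have hb : Continuous fun x : unitInterval ×
      ((fun v : {v : E // v ≠ 0} ↦ Projectivization.mk ℂ v.1 v.2) ⁻¹' linComplSet (T : E →ₗ[ℂ] F)) ↦
        blend (T : E →ₗ[ℂ] F) (S : F →ₗ[ℂ] E) x.1 x.2.1.1 := by
    simp only [blend, ContinuousLinearMap.coe_coe]
    exact ((S.continuous.comp (T.continuous.comp hv))).add
      (ht.smul (hv.sub (S.continuous.comp (T.continuous.comp hv))))
  have hc : Continuous fun x : unitInterval ×
      ((fun v : {v : E // v ≠ 0} ↦ Projectivization.mk ℂ v.1 v.2) ⁻¹' linComplSet (T : E →ₗ[ℂ] F)) ↦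
        (⟨blend (T : E →ₗ[ℂ] F) (S : F →ₗ[ℂ] E) x.1 x.2.1.1,
          blend_ne_zero (T : E →ₗ[ℂ] F) (S : F →ₗ[ℂ] E) hTS x.1 (hmem x.2)⟩ : {v : E // v ≠ 0}) :=
    hb.subtype_mk _
  exact (Projectivization.continuous_mk (𝕜 := ℂ) (W := E)).comp hc

/-- **`{[v] | T v ≠ 0}` retracts by deformation onto the linear section `[S(ℙ(F))]`**: the homotopy
`(t, [v]) ↦ [S(Tv) + t(v − S(Tv))]` from `linSect ∘ linProj` to the identity. [folklore] -/
def linHomotopy [IsTopologicalAddGroup E] [ContinuousSMul ℂ E] (hTS : ∀ w, T (S w) = w) :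
    ContinuousMap.Homotopy ((linSect T S hTS).comp (linProj T)) (ContinuousMap.id _) where
  toFun := linHomotopyFun T S hTS
  continuous_toFun := continuous_linHomotopyFun T S hTS
  map_zero_left q := by
    apply Subtype.ext
    simp only [linHomotopyFun, ContinuousMap.comp_apply]
    change _ = (linSectFun T S hTS (linProjFun T q)).1
    simp only [linSectFun, linProjFun]
    obtain ⟨a, ha⟩ := Projectivization.exists_smul_eq_mk_rep ℂ (T q.1.rep) q.2
    rw [Projectivization.mk_eq_mk_iff]
    refine ⟨a⁻¹, ?_⟩
    change a⁻¹ • S (Projectivization.mk ℂ (T q.1.rep) q.2).rep =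
      blend (T : E →ₗ[ℂ] F) (S : F →ₗ[ℂ] E) ((0 : unitInterval) : ℝ) q.1.rep
    rw [← ha, Units.smul_def, Units.smul_def, map_smul, smul_smul, Units.inv_mul, one_smul]
    exact (blend_zero (T : E →ₗ[ℂ] F) (S : F →ₗ[ℂ] E) q.1.rep).symm
  map_one_left q := by
    apply Subtype.ext
    simp only [linHomotopyFun, ContinuousMap.id_apply]
    conv_rhs => rw [← Projectivization.mk_rep q.1]
    congr 1
    exact blend_one (T : E →ₗ[ℂ] F) (S : F →ₗ[ℂ] E) q.1.rep

/-- **`{[v] | T v ≠ 0}` has no more cohomology than `ℙ(F)`**: if `Hᵏ(ℙ(F); ℂ) = 0` then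
`Hᵏ({[v] | T v ≠ 0}; ℂ) = 0`, for a continuous linear `T : E → F` with a continuous section `S`: by
homotopy invariance (Hatcher §3.1, p. 201; the tree's PROVED `singularCohomology.map_eq_of_homotopic'`)
the identity of `Hᵏ({T ≠ 0})` factors through `Hᵏ(ℙ(F)) = 0`. [cite: HatcherAT2002, §3.1 p. 201] -/
theorem subsingleton_singularCohomology_linComplSet [IsTopologicalAddGroup E] [ContinuousSMul ℂ E]
    (hTS : ∀ w, T (S w) = w) (k : ℕ) [Subsingleton (singularCohomology ℂ ℂ (ℙ ℂ F) k)] :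
    Subsingleton (singularCohomology ℂ ℂ (linComplSet (T : E →ₗ[ℂ] F)) k) := by
  refine ⟨fun x y ↦ ?_⟩
  have key : ∀ z : singularCohomology ℂ ℂ (linComplSet (T : E →ₗ[ℂ] F)) k, z = 0 := by
    intro z
    have h1 : singularCohomology.map ℂ ℂ (ContinuousMap.id (linComplSet (T : E →ₗ[ℂ] F))) k z = z := by
      rw [singularCohomology.map_id]; rfl
    rw [← h1, ← singularCohomology.map_eq_of_homotopic' ℂ ℂ ⟨linHomotopy T S hTS⟩ k,
      singularCohomology.map_comp, ModuleCat.comp_apply,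
      Subsingleton.elim (singularCohomology.map ℂ ℂ (linSect T S hTS) k z) 0, map_zero]
  rw [key x, key y]

end LinCompl

/-! ### Transport, and `Hᵏ(ℙᵐ(ℂ); ℂ) = 0` for `k > 2m` on Mathlib's projectivization -/

open Literature.NumberTheory.Transcendental (projPoint isHomeomorph_projPoint
  pt_projPoint_mk_mem_basicOpen_iff)
open MvPolynomial (C X)

attribute [local instance] MvPolynomial.gradedAlgebra

/-- A module isomorphic to a trivial one is trivial. [folklore] -/
theorem subsingleton_of_iso {R : Type} [CommRing R] {A B : ModuleCat.{u} R} (e : A ≅ B)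
    [Subsingleton A] : Subsingleton B := by
  refine ⟨fun x y ↦ ?_⟩
  have h : ∀ z : B, z = 0 := fun z ↦ by
    have hz : e.hom (e.inv z) = z := by rw [← ModuleCat.comp_apply, Iso.inv_hom_id]; rfl
    rw [← hz, Subsingleton.elim (e.inv z) 0, map_zero]
  rw [h x, h y]

/-- **`Hᵏ(ℙ(ℂ^{m+1}); ℂ) = 0` for `k > 2m`**: `ℙ(ℂ^{m+1})` is homeomorphic (`projPoint`, Serre GAGA
§2 n°5) to the complex points of the smooth projective `m`-fold `ℙᵐ_ℂ`, a closed `2m`-manifold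
(Hatcher Thm. 3.26 (c) with universal coefficients over a field; the tree's
`ComplexPoints.subsingleton_singularCohomology_of_lt`). [cite: HatcherAT2002, §3.3 Thm. 3.26 (c)] -/
theorem subsingleton_singularCohomology_projectivization {m k : ℕ} (hk : 2 * m < k) :
    Subsingleton (singularCohomology ℂ ℂ (ℙ ℂ (Fin (m + 1) → ℂ)) k) := by
  haveI := Motives.ComplexPoints.subsingleton_singularCohomology_of_lt
    (Motives.isSmoothProjective_projectiveSpace_holds ℂ m) ℂ hk
  exact subsingleton_of_iso (singularCohomology.mapIso ℂ ℂ (isHomeomorph_projPoint m).homeomorph k)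

/-! ### Linear forms and linear subspaces of `ℙᴺ_ℂ` -/

section LinearForms

variable (N : ℕ)

/-- The grading of `ℂ[x₀, …, x_N]` by degree (`ℙᴺ_ℂ = Proj 𝓐`). -/
local notation "𝓐" => MvPolynomial.homogeneousSubmodule (Fin (N + 1)) ℂ

/-- The linear form `ℓ_a = Σⱼ aⱼ xⱼ ∈ ℂ[x₀, …, x_N]` with coefficient vector `a`. [folklore] -/
def linForm (a : Fin (N + 1) → ℂ) : MvPolynomial (Fin (N + 1)) ℂ := ∑ j, C (a j) * X j

/-- `ℓ_a` is homogeneous of degree `1`. [folklore] -/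
theorem linForm_mem (a : Fin (N + 1) → ℂ) : linForm N a ∈ 𝓐 1 := by
  refine Submodule.sum_mem _ fun j _ ↦ ?_
  rw [MvPolynomial.mem_homogeneousSubmodule]
  simpa using (MvPolynomial.isHomogeneous_C _ (a j)).mul (MvPolynomial.isHomogeneous_X ℂ j)

/-- `ℓ_a(v) = Σⱼ aⱼ vⱼ`. [folklore] -/
@[simp]
theorem eval_linForm (a v : Fin (N + 1) → ℂ) : MvPolynomial.eval v (linForm N a) = ∑ j, a j * v j := by
  simp [linForm, map_sum]

/-- `a ↦ ℓ_a` is additive. [folklore] -/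
theorem linForm_add (a b : Fin (N + 1) → ℂ) : linForm N (a + b) = linForm N a + linForm N b := by
  simp only [linForm, Pi.add_apply, map_add, add_mul, Finset.sum_add_distrib]

/-- `a ↦ ℓ_a` is homogeneous. [folklore] -/
theorem linForm_smul (c : ℂ) (a : Fin (N + 1) → ℂ) : linForm N (c • a) = C c * linForm N a := by
  simp only [linForm, Pi.smul_apply, smul_eq_mul, map_mul, Finset.mul_sum, mul_assoc]

/-- `ℓ_0 = 0`. [folklore] -/
theorem linForm_zero : linForm N 0 = 0 := by simp [linForm]

/-- `ℓ_{eⱼ} = xⱼ`. [folklore] -/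
theorem linForm_single (j : Fin (N + 1)) : linForm N (Pi.single j 1) = X j := by
  classical
  rw [linForm, Finset.sum_eq_single j]
  · simp
  · intro i _ hij; simp [Pi.single_eq_of_ne hij]
  · simp

variable {N}

/-- The linear map `ℂ^{N+1} → ℂ^{m+1}`, `v ↦ (ℓ_{A i}(v))ᵢ`, with coordinate forms the rows `A i`.
[folklore] -/
def linMapOfRows {m : ℕ} (A : Fin (m + 1) → Fin (N + 1) → ℂ) :
    (Fin (N + 1) → ℂ) →L[ℂ] (Fin (m + 1) → ℂ) :=
  LinearMap.toContinuousLinearMap (Matrix.mulVecLin (Matrix.of A))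

/-- `(linMapOfRows A v)ᵢ = Σⱼ Aᵢⱼ vⱼ = ℓ_{A i}(v)`. [folklore] -/
theorem linMapOfRows_apply {m : ℕ} (A : Fin (m + 1) → Fin (N + 1) → ℂ) (v : Fin (N + 1) → ℂ)
    (i : Fin (m + 1)) : linMapOfRows A v i = ∑ j, A i j * v j := by
  simp [linMapOfRows, Matrix.mulVec, dotProduct]

/-- Linearly independent rows give a surjective row map (row rank = `m + 1`). [folklore] -/
theorem range_linMapOfRows_eq_top {m : ℕ} {A : Fin (m + 1) → Fin (N + 1) → ℂ}
    (hA : LinearIndependent ℂ A) :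
    LinearMap.range (linMapOfRows A : (Fin (N + 1) → ℂ) →ₗ[ℂ] (Fin (m + 1) → ℂ)) = ⊤ := by
  apply Submodule.eq_top_of_finrank_eq
  change Matrix.rank (Matrix.of A) = _
  have hA' : LinearIndependent ℂ (Matrix.of A).row := hA
  rw [hA'.rank_matrix, Fintype.card_fin, Module.finrank_fin_fun]

variable (N) in
/-- The linear subspace `V₊(ℓ_{A 0}, …, ℓ_{A (r-1)}) ⊆ ℙᴺ_ℂ`, a Zariski-closed subset of the scheme
`ℙᴺ_ℂ = Proj ℂ[x₀, …, x_N]`, cut out by the linear forms with coefficient rows `A`. [folklore] -/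
def linearSubspace {r : ℕ} (A : Fin r → Fin (N + 1) → ℂ) :
    Set (Motives.projectiveSpace N ℂ).left :=
  ProjectiveSpectrum.zeroLocus 𝓐 (Set.range fun i ↦ linForm N (A i))

/-- `V₊(ℓ_{A i})ᵢ` is Zariski-closed. [folklore] -/
theorem isClosed_linearSubspace {r : ℕ} (A : Fin r → Fin (N + 1) → ℂ) :
    IsClosed (linearSubspace N A) :=
  ProjectiveSpectrum.isClosed_zeroLocus 𝓐 _

/-- `x ∈ V₊(ℓ_{A i})ᵢ` iff every `ℓ_{A i}` lies in the homogeneous prime `𝔭_x`. [folklore] -/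
theorem mem_linearSubspace_iff {r : ℕ} (A : Fin r → Fin (N + 1) → ℂ)
    (x : (Motives.projectiveSpace N ℂ).left) :
    x ∈ linearSubspace N A ↔ ∀ i, linForm N (A i) ∈ x.asHomogeneousIdeal :=
  Set.range_subset_iff

/-- **Homogeneous coordinates off a linear subspace**: the complex point `[v]` of `ℙᴺ_ℂ` misses
`V₊(ℓ_{A i})ᵢ` iff `ℓ_{A i}(v) ≠ 0` for some `i` (`[v] ∈ D₊(g) ⟺ g(v) ≠ 0`, the tree's
`pt_projPoint_mk_mem_basicOpen_iff`). [cite: Hartshorne1977, II Prop. 2.5] -/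
theorem pt_projPoint_mk_notMem_linearSubspace_iff {m : ℕ} (A : Fin (m + 1) → Fin (N + 1) → ℂ)
    (v : Fin (N + 1) → ℂ) (hv : v ≠ 0) :
    (projPoint N (Projectivization.mk ℂ v hv)).pt ∉ linearSubspace N A ↔ linMapOfRows A v ≠ 0 := by
  rw [mem_linearSubspace_iff, not_forall, Function.ne_iff]
  refine exists_congr fun i ↦ ?_
  refine ((Proj.mem_basicOpen 𝓐 (linForm N (A i)) _).symm.trans
    (pt_projPoint_mk_mem_basicOpen_iff N v hv one_pos (linForm_mem N (A i)))).trans ?_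
  rw [eval_linForm, linMapOfRows_apply]
  exact Iff.rfl

/-- The complex points of `ℙᴺ_ℂ ∖ V₊(ℓ_{A i})ᵢ` (analytic topology) are homeomorphic, through the
comparison `projPoint : ℙ(ℂ^{N+1}) ≃ ℙᴺ_ℂ(ℂ)` (Serre, GAGA §2 n°5; the tree's
`isHomeomorph_projPoint`), to the open subset `{[v] | (ℓ_{A i}(v))ᵢ ≠ 0}` of `ℙ(ℂ^{N+1})`.
[cite: SerreGAGA1956, §2 n°5 Prop. 2] -/
def linComplHomeomorph {m : ℕ} (A : Fin (m + 1) → Fin (N + 1) → ℂ) :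
    linComplSet (linMapOfRows A : (Fin (N + 1) → ℂ) →ₗ[ℂ] (Fin (m + 1) → ℂ)) ≃ₜ
      Motives.complexPointsCompl (Motives.projectiveSpace N ℂ) (linearSubspace N A) :=
  (isHomeomorph_projPoint N).homeomorph.subtype (by
    intro q
    induction q using Projectivization.ind with | h v hv => ?_
    rw [mk_mem_linComplSet_iff]
    exact (pt_projPoint_mk_notMem_linearSubspace_iff A v hv).symm)

/-- **`Hᵏ((ℙᴺ ∖ L)(ℂ); ℂ) = 0` for `k > 2m`**, for `L = V₊(ℓ₀, …, ℓ_m) ⊂ ℙᴺ_ℂ` the linear subspace of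
codimension `m + 1` cut out by independent linear forms: `(ℙᴺ ∖ L)(ℂ)` retracts by deformation onto a
complementary `ℙᵐ(ℂ)` (`linHomotopy` with a linear section of the row map), a closed `2m`-manifold.
[cite: HatcherAT2002, §3.3 Thm. 3.26 (c) and §3.1 p. 201] -/
theorem subsingleton_singularCohomology_complexPointsCompl_linearSubspace {m : ℕ}
    {A : Fin (m + 1) → Fin (N + 1) → ℂ} (hA : LinearIndependent ℂ A) {k : ℕ} (hk : 2 * m < k) :
    Subsingleton (singularCohomology ℂ ℂ
      (Motives.complexPointsCompl (Motives.projectiveSpace N ℂ) (linearSubspace N A)) k) := by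
  obtain ⟨g, hg⟩ := LinearMap.exists_rightInverse_of_surjective
    (linMapOfRows A : (Fin (N + 1) → ℂ) →ₗ[ℂ] (Fin (m + 1) → ℂ)) (range_linMapOfRows_eq_top hA)
  have hTS : ∀ w, linMapOfRows A (LinearMap.toContinuousLinearMap g w) = w :=
    fun w ↦ LinearMap.congr_fun hg w
  haveI := subsingleton_singularCohomology_projectivization hk
  haveI := subsingleton_singularCohomology_linComplSet (linMapOfRows A)
    (LinearMap.toContinuousLinearMap g) hTS k
  exact subsingleton_of_iso (singularCohomology.mapIso ℂ ℂ (linComplHomeomorph A).symm k)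

end LinearForms

/-! ### Pull-backs of ambient classes vanish off the preimage -/

/-- **Restriction to open complements is functorial**: for `ι : Y ⟶ ℙᴺ_ℂ` and `Z ⊆ ℙᴺ`, the
restriction of `ι^* a` to `(Y ∖ ι⁻¹Z)(ℂ)` is the pull-back, along `(Y ∖ ι⁻¹Z)(ℂ) → (ℙᴺ ∖ Z)(ℂ)`, of
the restriction of `a` to `(ℙᴺ ∖ Z)(ℂ)`; so it vanishes as soon as `Hᵏ((ℙᴺ ∖ Z)(ℂ); ℂ) = 0`.
[cite: GrothendieckTopology1969, §1] -/
theorem restrictCompl_preimage_map_eq_zero {N : ℕ} {Y : Motives.SchemeOver ℂ}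
    (ι : Y ⟶ Motives.projectiveSpace N ℂ) (Z : Set (Motives.projectiveSpace N ℂ).left) (k : ℕ)
    [Subsingleton (singularCohomology ℂ ℂ
      (Motives.complexPointsCompl (Motives.projectiveSpace N ℂ) Z) k)]
    (a : complexBetti (Motives.projectiveSpace N ℂ) k) :
    complexBetti.restrictCompl Y (ι.left.base ⁻¹' Z) k (complexBetti.map ι k a) = 0 := by
  let jY : C(Motives.complexPointsCompl Y (ι.left.base ⁻¹' Z), Motives.ComplexPoints Y) :=
    ⟨Subtype.val, continuous_subtype_val⟩
  let jP : C(Motives.complexPointsCompl (Motives.projectiveSpace N ℂ) Z,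
      Motives.ComplexPoints (Motives.projectiveSpace N ℂ)) :=
    ⟨Subtype.val, continuous_subtype_val⟩
  let ιc : C(Motives.complexPointsCompl Y (ι.left.base ⁻¹' Z),
      Motives.complexPointsCompl (Motives.projectiveSpace N ℂ) Z) :=
    ⟨fun P ↦ ⟨Motives.AlgPoints.map ι P.1, P.2⟩,
      ((Motives.AlgPoints.continuous_map ι).comp continuous_subtype_val).subtype_mk _⟩
  have hsq : (Motives.AlgPoints.mapContinuous (L := ℂ) ι).comp jY = jP.comp ιc := rfl
  change (singularCohomology.map ℂ ℂ (Motives.AlgPoints.mapContinuous (L := ℂ) ι) k ≫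
    singularCohomology.map ℂ ℂ jY k) a = 0
  rw [← singularCohomology.map_comp, hsq, singularCohomology.map_comp, ModuleCat.comp_apply,
    Subsingleton.elim (singularCohomology.map ℂ ℂ jP k a) 0, map_zero]

/-! ### Linear sections in general position of a smooth projective `n`-fold mapped to `ℙᴺ` -/

section LinearSections

variable {N : ℕ}

/-- The grading of `ℂ[x₀, …, x_N]` by degree (`ℙᴺ_ℂ = Proj 𝓐`). -/
local notation "𝓐" => MvPolynomial.homogeneousSubmodule (Fin (N + 1)) ℂ

/-- Every point of the scheme `ℙᴺ_ℂ` lies in some standard open `D₊(xⱼ)` (the irrelevant ideal is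
generated by the variables; the tree's `ProjectiveSpace.irrelevant_le_span`).
[cite: Hartshorne1977, II Prop. 2.5] -/
theorem exists_mem_basicOpen_X (x : (Motives.projectiveSpace N ℂ).left) :
    ∃ j : Fin (N + 1), x ∈ Proj.basicOpen 𝓐 (X j) := by
  have htop := Proj.iSup_basicOpen_eq_top 𝓐 (X : Fin (N + 1) → MvPolynomial (Fin (N + 1)) ℂ)
    (Motives.ProjectiveSpace.irrelevant_le_span N ℂ)
  have hx : x ∈ (⨆ i, Proj.basicOpen 𝓐 (X i : MvPolynomial (Fin (N + 1)) ℂ)) := by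
    rw [htop]; trivial
  exact TopologicalSpace.Opens.mem_iSup.mp hx

/-- The coefficient vectors `a` whose linear form vanishes at the point `x ∈ ℙᴺ_ℂ` (`ℓ_a ∈ 𝔭_x`): a
linear subspace of `ℂ^{N+1}`. [folklore] -/
def vanishingForms (x : (Motives.projectiveSpace N ℂ).left) : Submodule ℂ (Fin (N + 1) → ℂ) where
  carrier := {a | linForm N a ∈ x.asHomogeneousIdeal}
  add_mem' {a b} ha hb := by
    simp only [Set.mem_setOf_eq, linForm_add] at ha hb ⊢
    exact Ideal.add_mem _ ha hb
  zero_mem' := by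
    simp only [Set.mem_setOf_eq, linForm_zero]
    exact Ideal.zero_mem _
  smul_mem' c a ha := by
    simp only [Set.mem_setOf_eq, linForm_smul] at ha ⊢
    exact Ideal.mul_mem_left _ _ ha

/-- Membership in `vanishingForms x` (definitional unfolding). [folklore] -/
theorem mem_vanishingForms_iff (x : (Motives.projectiveSpace N ℂ).left) (a : Fin (N + 1) → ℂ) :
    a ∈ vanishingForms x ↔ linForm N a ∈ x.asHomogeneousIdeal :=
  Iff.rfl

/-- **Not every linear form vanishes at a given point of `ℙᴺ`**: points of `Proj` are relevant
primes, so some `xⱼ ∉ 𝔭_x`. [cite: Hartshorne1977, II Prop. 2.5] -/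
theorem vanishingForms_ne_top (x : (Motives.projectiveSpace N ℂ).left) : vanishingForms x ≠ ⊤ := by
  obtain ⟨j, hj⟩ := exists_mem_basicOpen_X x
  intro h
  have hmem : (Pi.single j 1 : Fin (N + 1) → ℂ) ∈ vanishingForms x := h ▸ Submodule.mem_top
  rw [mem_vanishingForms_iff, linForm_single] at hmem
  exact (Proj.mem_basicOpen 𝓐 _ _).1 hj hmem

variable {n : ℕ} {Y : Motives.SchemeOver ℂ}

/-- **Linear forms in general position with respect to `Y → ℙᴺ`** (dimension count, Hartshorne I
Thm. 7.2 / I Ex. 1.8: a hypersurface not containing an irreducible variety cuts its dimension down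
by one). For `Y` smooth projective of dimension `n` over `ℂ` with a morphism `ι : Y → ℙᴺ_ℂ` and
`j ≤ N + 1`, there are `j` linearly independent linear forms `ℓ₁, …, ℓ_j` on `ℙᴺ` such that every
point `z ∈ Y` with `ι(z) ∈ V₊(ℓ₁, …, ℓ_j)` has `dim {z}⁻ + j ≤ n` (`Order.height z` in the
specialisation order `=` dimension of the closure). Induction on `j`: `ℓ_{j+1}` is chosen off the
finitely many proper subspaces of forms vanishing at the generic points of the irreducible
components of `ι⁻¹V₊(ℓ₁, …, ℓ_j)` (a closed subset of the Noetherian sober space `Y`) and off the span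
of `ℓ₁, …, ℓ_j` (`j < N + 1`), a finite union of proper subspaces of `ℂ^{N+1}` being proper
(Mathlib `Submodule.exists_forall_notMem_of_forall_ne_top`); a point of the new section lies in the
closure of such a generic point `η` and differs from it, so its height drops below `height η`.
[cite: Hartshorne1977, I Thm. 7.2 and I Ex. 1.8] -/
theorem exists_linForms_height_add_le (hY : Motives.IsSmoothProjective n Y)
    (ι : Y ⟶ Motives.projectiveSpace N ℂ) :
    ∀ j : ℕ, j ≤ N + 1 → ∃ A : Fin j → Fin (N + 1) → ℂ, LinearIndependent ℂ A ∧
      ∀ z : Y.left, (∀ i, linForm N (A i) ∈ (ι.left.base z).asHomogeneousIdeal) →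
        Order.height z + j ≤ n := by
  haveI := hY.smoothOfRelativeDimension
  haveI := hY.geometricallyIrreducible
  haveI : IrreducibleSpace ↥Y.left := GeometricallyIrreducible.irreducibleSpace_of_subsingleton Y.hom
  haveI := Motives.IsSmoothProjective.isLocallyNoetherian_holds hY
  haveI := Motives.IsSmoothProjective.compactSpace_holds hY
  haveI : IsNoetherian Y.left := {}
  have hdim : ∀ z : Y.left, Order.height z + Order.coheight z = n :=
    Motives.height_add_coheight_eq_of_smoothOfRelativeDimension Y.hom n
  intro j
  induction j with
  | zero =>
    intro _
    refine ⟨fun i ↦ Fin.elim0 i, linearIndependent_empty_type, fun z _ ↦ ?_⟩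
    calc Order.height z + ((0 : ℕ) : ℕ∞) = Order.height z := by simp
      _ ≤ Order.height z + Order.coheight z := le_self_add
      _ = n := hdim z
  | succ j ih =>
    intro hj
    obtain ⟨A, hA, hAz⟩ := ih (by omega)
    -- the closed subset `S = ι⁻¹ V₊(ℓ_{A i})ᵢ` of the Noetherian sober space `Y`
    set S : Set Y.left := {z | ∀ i, linForm N (A i) ∈ (ι.left.base z).asHomogeneousIdeal} with hSdef
    have hSeq : S = ι.left.base ⁻¹' linearSubspace N A :=
      Set.ext fun z ↦ (mem_linearSubspace_iff A (ι.left.base z)).symm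
    have hS : IsClosed S := hSeq ▸ (isClosed_linearSubspace A).preimage ι.left.continuous
    haveI : QuasiSober S := hS.isClosedEmbedding_subtypeVal.quasiSober
    haveI : Finite (irreducibleComponents S) :=
      (TopologicalSpace.NoetherianSpace.finite_irreducibleComponents (α := S)).to_subtype
    -- the generic points of the irreducible components of `S`: finitely many, and every point of
    -- `S` specialises from one of them
    let G : Set Y.left :=
      Set.range fun t : irreducibleComponents S ↦ ((t.2.1.genericPoint : S) : Y.left)
    have hGfin : G.Finite := Set.finite_range _
    have hGS : G ⊆ S := by rintro _ ⟨t, rfl⟩; exact Subtype.prop _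
    have hGcover : ∀ z ∈ S, ∃ η ∈ G, η ⤳ z := by
      intro z hz
      have ht : irreducibleComponent (⟨z, hz⟩ : S) ∈ irreducibleComponents S :=
        irreducibleComponent_mem_irreducibleComponents _
      refine ⟨_, ⟨⟨_, ht⟩, rfl⟩, ?_⟩
      have hgen : IsGenericPoint ht.1.genericPoint (closure (irreducibleComponent (⟨z, hz⟩ : S))) :=
        ht.1.isGenericPoint_genericPoint_closure
      rw [isClosed_irreducibleComponent.closure_eq] at hgen
      exact (hgen.specializes mem_irreducibleComponent).map continuous_subtype_val
    -- a linear form avoiding the generic points and the span of the previous forms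
    haveI : Finite G := hGfin.to_subtype
    let P : Option G → Submodule ℂ (Fin (N + 1) → ℂ) := fun o ↦
      o.elim (Submodule.span ℂ (Set.range A)) fun η ↦ vanishingForms (ι.left.base η.1)
    have hP : ∀ o, P o ≠ ⊤ := by
      rintro (_ | η)
      · intro h
        have h1 : Module.finrank ℂ (Submodule.span ℂ (Set.range A)) = j := by
          rw [finrank_span_eq_card hA, Fintype.card_fin]
        change Submodule.span ℂ (Set.range A) = ⊤ at h
        rw [h, finrank_top, Module.finrank_fin_fun] at h1
        omega
      · exact vanishingForms_ne_top _
    obtain ⟨a, ha⟩ := Submodule.exists_forall_notMem_of_forall_ne_top P hP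
    refine ⟨Fin.snoc A a, linearIndependent_finSnoc.2 ⟨hA, ha none⟩, fun z hz ↦ ?_⟩
    have hzS : z ∈ S := fun i ↦ by simpa only [Fin.snoc_castSucc] using hz (Fin.castSucc i)
    have hza : linForm N a ∈ (ι.left.base z).asHomogeneousIdeal := by
      simpa only [Fin.snoc_last] using hz (Fin.last j)
    obtain ⟨η, hηG, hηz⟩ := hGcover z hzS
    have hne : z ≠ η := by
      rintro rfl
      exact ha (some ⟨z, hηG⟩) hza
    have hlt : z < η := lt_iff_le_not_ge.2 ⟨Scheme.le_iff_specializes.2 hηz,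
      fun h ↦ hne ((Scheme.le_iff_specializes.1 h).antisymm hηz).eq⟩
    have hfin : Order.height z < ⊤ :=
      lt_of_le_of_lt (le_self_add.trans (hdim z).le) (ENat.coe_lt_top n)
    have h1 : Order.height z + 1 ≤ Order.height η :=
      Order.add_one_le_of_lt (Order.height_strictMono hlt hfin)
    calc Order.height z + ((j + 1 : ℕ) : ℕ∞) = Order.height z + 1 + j := by
          rw [Nat.cast_succ, ← add_assoc, add_right_comm]
      _ ≤ Order.height η + j := add_le_add_left h1 _
      _ ≤ n := hAz η (hGS hηG)

/-- **A linear section of codimension `m + 1` in general position has codimension `≥ m + 1` in `Y`,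
pointwise**: for `Y` smooth projective of dimension `n`, `ι : Y → ℙᴺ_ℂ` and `m ≤ N`, there are
independent linear forms `ℓ₀, …, ℓ_m` such that every point of `ι⁻¹V₊(ℓ₀, …, ℓ_m)` has codimension
`coheight ≥ m + 1` in `Y` (`dim {z}⁻ + codim {z}⁻ = n` on the smooth irreducible `Y`, Hartshorne II
Ex. 3.20 (d), the tree's `height_add_coheight_eq_of_smoothOfRelativeDimension`).
[cite: Hartshorne1977, I Thm. 7.2 and II Ex. 3.20 (d)] -/
theorem exists_linearSubspace_le_coheight (hY : Motives.IsSmoothProjective n Y)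
    (ι : Y ⟶ Motives.projectiveSpace N ℂ) {m : ℕ} (hm : m + 1 ≤ N + 1) :
    ∃ A : Fin (m + 1) → Fin (N + 1) → ℂ, LinearIndependent ℂ A ∧
      ∀ z ∈ ι.left.base ⁻¹' linearSubspace N A, ((m + 1 : ℕ) : ℕ∞) ≤ Order.coheight z := by
  obtain ⟨A, hA, hAz⟩ := exists_linForms_height_add_le hY ι (m + 1) hm
  refine ⟨A, hA, fun z hz ↦ ?_⟩
  haveI := hY.smoothOfRelativeDimension
  haveI := hY.geometricallyIrreducible
  haveI : IrreducibleSpace ↥Y.left := GeometricallyIrreducible.irreducibleSpace_of_subsingleton Y.hom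
  have hdim : Order.height z + Order.coheight z = n :=
    Motives.height_add_coheight_eq_of_smoothOfRelativeDimension Y.hom n z
  have hfin : Order.height z ≠ ⊤ :=
    (lt_of_le_of_lt (le_self_add.trans hdim.le) (ENat.coe_lt_top n)).ne
  have h := hAz z ((mem_linearSubspace_iff A (ι.left.base z)).1 hz)
  rw [← hdim] at h
  exact (WithTop.add_le_add_iff_left hfin).1 h

end LinearSections

/-! ### Restrictions of ambient classes are algebraic -/

section Ambient

open Literature.AlgebraicGeometry.Motives

variable {n N : ℕ} {Y : Motives.SchemeOver ℂ}

/-- **Classes restricted from projective space are algebraic.** For `Y` smooth projective of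
dimension `n` over `ℂ`, a morphism `ι : Y → ℙᴺ_ℂ` and any `p`, the pull-back `ι^* a` of every
`a ∈ H²ᵖ(ℙᴺ(ℂ); ℂ)` lies in `algebraicClasses Y p = Nᵖ H²ᵖ(Y(ℂ); ℂ)`: it vanishes on
`(Y ∖ ι⁻¹L)(ℂ)` for a codimension-`p` linear subspace `L ⊂ ℙᴺ` in general position (`ι⁻¹L` of
codimension `≥ p` in `Y`, `exists_linearSubspace_le_coheight`), because `a` itself vanishes on
`(ℙᴺ ∖ L)(ℂ)`, which retracts onto a `ℙᵖ⁻¹(ℂ)` with no cohomology in degree `2p`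
(`subsingleton_singularCohomology_complexPointsCompl_linearSubspace`); `p = 0` is
`algebraicClasses_zero`, and for `p > N` already `H²ᵖ(ℙᴺ(ℂ); ℂ) = 0`. Classically:
`H²ᵖ(ℙᴺ, ℤ) = ℤhᵖ` and `hᵖ|_Y = cl(Y ∩ L)` is the class of an algebraic cycle (Voisin I §11.1.2;
Voisin II §1.2.3, proof of Cor. 1.24 and Rem. 1.26, "a curve `C = X ∩ ℙ²` is of degree `d` and is
thus of class `dα`"). [cite: VoisinHodgeII2003, §1.2.3 Cor. 1.24 and Rem. 1.26 (PDF p. 62)] -/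
theorem map_projectiveSpace_mem_algebraicClasses (hY : IsSmoothProjective n Y)
    (ι : Y ⟶ projectiveSpace N ℂ) (p : ℕ) (a : complexBetti (projectiveSpace N ℂ) (2 * p)) :
    complexBetti.map ι (2 * p) a ∈ algebraicClasses Y p := by
  rcases Nat.eq_zero_or_pos p with rfl | hp0
  · rw [algebraicClasses_zero]; exact Submodule.mem_top
  by_cases hpN : p ≤ N
  · obtain ⟨m, rfl⟩ : ∃ m, p = m + 1 := ⟨p - 1, by omega⟩
    obtain ⟨A, hA, hcodim⟩ := exists_linearSubspace_le_coheight hY ι (m := m) (by omega)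
    haveI := subsingleton_singularCohomology_complexPointsCompl_linearSubspace hA
      (k := 2 * (m + 1)) (by omega)
    exact mem_supportedClasses_of_restrictCompl_eq_zero
      ((isClosed_linearSubspace A).preimage ι.left.continuous) hcodim
      (restrictCompl_preimage_map_eq_zero ι (linearSubspace N A) _ a)
  · haveI := ComplexPoints.subsingleton_singularCohomology_of_lt
      (isSmoothProjective_projectiveSpace_holds ℂ N) ℂ (k := 2 * p) (by omega)
    rw [Subsingleton.elim a 0, map_zero]
    exact Submodule.zero_mem _

/-- The image of `ι^* : H²ᵖ(ℙᴺ(ℂ); ℂ) → H²ᵖ(Y(ℂ); ℂ)` consists of algebraic classes (submodule form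
of `map_projectiveSpace_mem_algebraicClasses`). [cite: VoisinHodgeII2003, §1.2.3 Cor. 1.24 (PDF p. 62)] -/
theorem range_map_projectiveSpace_le_algebraicClasses (hY : IsSmoothProjective n Y)
    (ι : Y ⟶ projectiveSpace N ℂ) (p : ℕ) :
    LinearMap.range (complexBetti.map ι (2 * p)).hom ≤ algebraicClasses Y p := by
  rintro _ ⟨a, rfl⟩
  exact map_projectiveSpace_mem_algebraicClasses hY ι p a

/-- **All of `H²ᵖ(Y(ℂ); ℂ)` is algebraic as soon as it is restricted from projective space**: if
`ι^* : H²ᵖ(ℙᴺ(ℂ); ℂ) → H²ᵖ(Y(ℂ); ℂ)` is onto — as the Lefschetz theorem on hyperplane sections gives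
for a smooth hypersurface `Y ⊂ ℙ^{n+1}` off the middle degree (Voisin II Thm. 1.23 with
Cor. 1.24–1.25: `H²ᵖ(Y, ℚ) = ℚ · hᵖ|_Y` for `2p ≠ n`) — then `algebraicClasses Y p = ⊤`. This reduces
the named fact `Voisin2003_smoothHypersurface_algebraicClasses_eq_top` to exactly that surjectivity.
[cite: VoisinHodgeII2003, §1.2.2 Thm. 1.23 and §1.2.3 Cor. 1.24–1.25 (PDF pp. 60–62)] -/
theorem algebraicClasses_eq_top_of_surjective_map (hY : IsSmoothProjective n Y)
    (ι : Y ⟶ projectiveSpace N ℂ) {p : ℕ} (hι : Function.Surjective (complexBetti.map ι (2 * p))) :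
    algebraicClasses Y p = ⊤ := by
  refine eq_top_iff.2 fun c _ ↦ ?_
  obtain ⟨a, rfl⟩ := hι c
  exact map_projectiveSpace_mem_algebraicClasses hY ι p a

end Ambient

end Literature.AlgebraicGeometry.HodgeTheory
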